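import Literature.AnabelianGeometry.AbsoluteAnabelian.AbsTopIThm26iii
import HarnessLib

/-!
# [AbsTopI] Lemma 2.7 (iii) — the Tate-module input of Thm 2.6 (iii), statement only

S. Mochizuki, *Topics in Absolute Anabelian Geometry I: Generalities*, J. Math. Sci. Univ. Tokyo
**19** (2012) [AbsTopI]: Lemma 2.7 ("Combinatorial Quotients of Tate Modules") p. 24, and the
proof of Thm 2.6 (iii) p. 23 l. 31–47, which consumes it.

abc-iut cell (block C), row «LEM27iii-TYPE» (abc-iut-L4-lead RULING #8h (1)), seat abc-iut-w6-d073.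
STATEMENT-ONLY file: ONE named fact, `FundamentalExtension.Lem27iiiStep`, and the successor row
`FundamentalExtension.Thm26iii'` it closes; the fact is typed in the tree's
`δ`-vocabulary (`freeProlRank` = `δ¹`, `deltaInv · 2` = `δ²`, `thetaSet` = `θ`) as a predicate on an
extension `1 → Δ → Π → G → 1` (`FundamentalExtension`) and its construction-data prime set `Σ`.

PRINT.  Setting: `k` an MLF, `X` a hyperbolic orbicurve over `k`, `Π = π₁(X) ↠ G = G_k` with kernel
`Δ = Δ_X^Σ` (Def 2.1).  Lemma 2.7: for a semi-abelian variety `B` over `k` with Tate module `T(B)`,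
(i) the maximal torsion-free quotient `T(B) ↠ Q` with trivial `G_k`-action is a finitely generated free
`Ẑ`-module; (ii) there is a quotient `T(B) ↠ R`, `R` a finitely generated free `Ẑ`-module on which `G_k`
acts through a finite quotient, whose kernel `N` has no nonzero torsion-free subquotient with such an
action; (iii) "the natural map `H¹(G_k, Hom(R, Ẑ)) → H¹(G_k, Hom(T(B), Ẑ))` is injective".  Proof of
Thm 2.6 (iii), p. 23: "Since `G` is of cohomological dimension 2 [...] and `δ²_l(G) = 0` [...] the
spectral sequence yields [...] a pair of injections
`H¹(G, Hom(R_l, ℚ_l)) ↪ H¹(G, Hom(Δ^{ab-t}, ℚ_l)) ↪ H²(Π, ℚ_l)` if `l ∈ Σ` [cf. Lemma 2.7, (iii)]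
[...] there exists some open subgroup `H ⊆ Π` and some `l ∈ Primes` such that `δ¹_l(H) ≥ 2`, `l ≠ p`.
Now we may assume without loss of generality that `H` acts trivially on the quotient `R`; [...] replace
`Π` by `H` [...].  Then [since `δ¹_l(G) = 1`, by assertion (ii)] the fact that `δ¹_l(Π) ≥ 2` implies
that `l ∈ Σ`, and `dim_{ℚ_l}(R_l ⊗ ℚ_l) ≥ 1` [cf. our computation in the proof of assertion (ii)].  But
this implies that for any `l′ ∈ Σ`, we have `dim_{ℚ_{l′}}(R_{l′} ⊗ ℚ_{l′}) ≥ 1`, hence that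
`H¹(G, Hom(R_{l′}, ℚ_{l′})) = H¹(G, ℚ_{l′}) ⊗ Hom(R_{l′}, ℚ_{l′}) ≠ 0`.  Thus, by the injections
discussed above, we conclude that `ε²_{l′}(Π) ≥ δ²_{l′}(Π) ≥ 1`, so `l′ ∈ θ²(Π)`."

WHAT IS TYPED.  The group-theoretic residue of that paragraph — everything in it that is NOT a theorem
of the abstract hypotheses ⟨MLF base, `Π` tfg, `Δ` pro-`Σ`⟩ (abc-iut finding F-w6d073-1, kernel
witness `FundamentalExtension.exists_mlfBase_not_thm26iii`): for an open `H ⊆ Π`, a POSITIVE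
(ii)-rank excess `δ¹_{l₀}(H) − δ¹_{l₀}(G_H) = dim_{ℚ_{l₀}}(R_{l₀} ⊗ ℚ_{l₀})` at ONE `l₀ ∈ Σ` forces, for
EVERY prime `l ∈ Σ`, an open `H′ ⊆ H` (the subgroup acting trivially on `R`) with `δ²_l(H′) ≥ 1` —
i.e. Lemma 2.7 (ii) ("`R` is a free `Ẑ`-module": its `l`-adic rank does not depend on `l`) with Lemma
2.7 (iii) and the Leray injection into `H²`.  The surrounding group theory (`|θ¹(Π)| ≥ 2 ⇒` such
`H, l₀` exist with `l₀ ∈ Σ`; `δ²_l(H′) ≥ 1 ⇒ l ∈ θ²`) is proved in the bridges file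
`AbsTopILem27iiiBridges.lean`, which derives from this fact the second clause of the typed Thm 2.6
(iii) (`FundamentalExtension.Thm26iii`) for `Π` and for every open `H ⊆ Π`, and the `Σ = Primes`
regime of Thm 2.6 (v) (`FundamentalExtension.Thm26vFull`).

HONEST LABEL.  A predicate on data: print proves it for `Π` of GEOMETRIC ORIGIN (Tate module of the
Albanese of the coverings of `X`, weights — [AbsAnab] Lemma 1.1.5); it is not a theorem of the
abstract hypotheses and is taken BY NAME where (iii) is consumed.  The module-theoretic Lemma 2.7 (iii)
itself (an injectivity statement about `H¹` of an abstract profinite `G_k`-module datum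
`T ↠ R`, provable from the long exact cohomology sequence and `H⁰(G_k, Hom(N, Ẑ)) = 0`) is not typed
here.  Nothing in this file bears on [IUTchIII] Cor. 3.12; typed ≠ proved.
-/

namespace Literature.AnabelianGeometry.AbsoluteAnabelian

namespace FundamentalExtension

universe u

variable (E : FundamentalExtension.{u})

/-- **[AbsTopI] Lemma 2.7 (ii)+(iii) as consumed by the proof of Thm 2.6 (iii)** (p. 23 l. 36–47),
typed in the `δ`-vocabulary as a predicate on the extension `1 → Δ → Π → G → 1` and its
construction-data prime set `Σ`: for every open subgroup `H ⊆ Π` (image `G_H ⊆ G`), if the rank excess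
`δ¹_{l₀}(H) − δ¹_{l₀}(G_H)` of Thm 2.6 (ii) [`= dim_{ℚ_{l₀}}(R_{l₀} ⊗ ℚ_{l₀})`, `R` the combinatorial
quotient of the Tate module of the Albanese, Lemma 2.7 (ii)] is positive at some `l₀ ∈ Σ`, then for
EVERY prime `l ∈ Σ` ["`R` is a free `Ẑ`-module", so `dim(R_l ⊗ ℚ_l) ≥ 1` too] some open subgroup
`H′ ⊆ H` [the one acting trivially on `R`] satisfies `δ²_l(H′) ≥ 1` [the injections
`0 ≠ H¹(G_{H′}, Hom(R_l, ℚ_l)) ↪ H¹(G_{H′}, Hom(Δ_{H′}^{ab-t}, ℚ_l)) ↪ H²(H′, ℚ_l)` of Lemma 2.7 (iii)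
and of the Leray spectral sequence].  Holds for `Π = π₁` of a hyperbolic orbicurve over an MLF with
`Δ = Δ_X^Σ` (geometric origin); a hypothesis on data for an abstract extension.
[cite: MochizukiAbsTopI2012, Lemma 2.7 (iii) p.24] -/
def Lem27iiiStep (S : Set ℕ) : Prop :=
  ∀ (H : Subgroup E.arith), IsOpen (H : Set E.arith) →
    ∀ (l₀ : ℕ) [Fact l₀.Prime], l₀ ∈ S →
      freeProlRank (H.map E.aug.toMonoidHom) l₀ < freeProlRank H l₀ →
        ∀ (l : ℕ) [Fact l.Prime], l ∈ S →
          ∃ H' : Subgroup E.arith, IsOpen (H' : Set E.arith) ∧ H' ≤ H ∧ 1 ≤ deltaInv H' 2 l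

/-- **Successor typed row `Thm26iii′`** — [AbsTopI] Thm 2.6 (iii) WITH its printed standing
hypotheses and the Tate-module input made explicit: for an extension with MLF base data
(`Nonempty E.MLFBase`: `G ≅ G_k`, `k` an MLF), if `Π` is topologically finitely generated (Thm 2.6
(ii)), `Δ` is pro-`Σ` (construction datum, Def 2.1) and the Lemma 2.7 step `Lem27iiiStep` holds, then
the typed Thm 2.6 (iii) `E.Thm26iii S` ("`θ²(Π) ⊆ Σ`, with equality if `|θ¹(Π)| ≥ 2`") holds.  Its
universal closure is PROVED in `AbsTopILem27iiiBridges.lean` (`thm26iii'_holds`); abc-iut successor of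
the data-alias row `Thm26iii` (finding F-w6d073-1: without the Lemma 2.7 input the second clause is not
a theorem of the abstract hypotheses). [cite: MochizukiAbsTopI2012, Thm 2.6 (iii) p.22] -/
def Thm26iii' (S : Set ℕ) : Prop :=
  Nonempty E.MLFBase → IsTopologicallyFinitelyGenerated E.arith → IsProSet E.geom S →
    E.Lem27iiiStep S → E.Thm26iii S

-- TODO(general form): [AbsTopI] Lemma 2.7 (iii) itself — for a profinite `G_k`-module datum
-- `T ↠ R` as in Lemma 2.7 (ii), `H¹(G_k, Hom(R, Ẑ)) → H¹(G_k, Hom(T, Ẑ))` is injective — and the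
-- Leray injection `H¹(G, H¹(Δ, ℚ_l)) ↪ H²(Π, ℚ_l)` (from `cd G = 2`, `δ²_l(G) = 0`) are module-level
-- statements whose typing needs a `G_k`-module datum not in the tree's vocabulary.

end FundamentalExtension

end Literature.AnabelianGeometry.AbsoluteAnabelian
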